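import Mathlib
import HarnessLib
import Summits.NavierStokesRegularity.NavierStokesRegularity.Theorems.LocalSineTubeDoorLocalPointZoomGradSlices
import Summits.NavierStokesRegularity.NavierStokesRegularity.Theorems.LocalSineTubeDoorWindowFatou
import Summits.NavierStokesRegularity.NavierStokesRegularity.Theorems.PlaneStrainDoorZoomSpaceTimeDecay
import Summits.NavierStokesRegularity.NavierStokesRegularity.Theorems.SelfStrainDoorProfileRigidity

/-!
# Door S22 «SelfStrainDoor» (nsreg-p1 ROUND-21; THEOREMS-ONLY landing) — file 5/5: THE DOOR, unconditionally
# «local space–time Type I + the scale-normalised SELF-STRAIN fades in L¹ on ONE similarity window ⇒ backward bounded»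

Lane `ns-pressure-K2-p1` g5 (DIRECTOR-NS g9 #54 (1)/#57/#60 (1)); design, texts and the residue proof by nsreg-p1 g18/g19
(`HOME/ns-regularity-ideate-p1/ROUND-21.md` 0ca10a4359a7bf66, `P1/r21/S22EndToEnd.lean` 9b9b0bcc57046adf).  The planner's
end-to-end file derived the door from the family-common zoom statement `LocalPointZoomC1Lambda` (with `Λ = (−Δ)^{1/2}`
convergence, not a tree theorem); since the self-strain `σ(u) = ⟪u, Du[u]⟫` sees only `(u, ∇u)`, the door is obtained here
WITHOUT that hypothesis, from the tree's universal first-order zoom and window glue: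

* `localPointZoomSelfStrainWindow` — **K1** (text of the planner's `LocalPointZoomSelfStrainWindow` verbatim): under the local
  space–time Type-I bound at `(x₀,T)`, the `L¹`-fading of `(T−t)²|σ(u(t))(x₀+√(T−t)·)|` on one open window and backward
  unboundedness, the zoom profile is of the door class (rate, space–time decay `…PlaneStrainDoorZoomSpaceTimeDecay.hasTypeIDecay_of_zoom`,
  continuity, Oseen–Duhamel identity, divergence-free slices), backward-singular at the apex, and self-strain-free on a
  nonempty open set of every slice — `…LocalSineTubeDoorLocalPointZoomGradSlices.localPointZoomVelGradSlices` +
  `…LocalSineTubeDoorWindowFatou.windowFatou_firstOrder_of_zeroSetInvariant` with the continuous first-order scalar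
  `F(x, A) = ⟪x, A x⟫`, whose zero set is dilation invariant (`F(a•x, b•A) = a²b F(x, A)`);
* `selfStrainDoor` — **THE DOOR S22** (text of the planner's `Target` verbatim): a classical Leray–Hopf flow from rapidly
  decaying data, locally SPACE–TIME Type I at `(x₀,T)`, whose scale-normalised self-strain fades in `L¹` on ONE nonempty open
  similarity window, is backward bounded at `x₀` — by K1 and the residue K2
  `…SelfStrainDoorProfileRigidity.selfStrainFreeProfileRigidity` (PROVED: windowed cubic budget + ESS in the class).

Honest label (ROUND-21 §3/§5): a CONDITIONAL door theorem of the local Type-I window-door family (S13/S15/S16/S20/S21/S22):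
the Type-I rate and the fading of the fine structure are HYPOTHESES; it evades the hard cores (0056 `NoTypeII`, 10661
`TypeIliouvilleL`, 1217 STA) by hypothesis and does not attack them.  Nearest print (ROUND-21 §6): Vasseur 2009
(`div(u/|u|)`-criterion, global, `L^p_tL^q_x`) — different functional, frame and mechanism.

WHAT THIS IS NOT: not NS regularity (Clay A); no route, no item (standing #32 (2)); bears_on LADDER-NS N0 door family S22.
-/

noncomputable section

-- the summit and its single sub-problem share the name (CONVENTIONS §1), as in every Theorems file
set_option linter.dupNamespace false

namespace Summit.NavierStokesRegularity.NavierStokesRegularity.Theorems.SelfStrainDoor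

open MeasureTheory Set Function Filter Topology TopologicalSpace Metric InnerProductSpace
open scoped RealInnerProductSpace InnerProductSpace NNReal ENNReal
open Literature.Analysis Literature.Analysis.FluidPDE
open Summit.NavierStokesRegularity.NavierStokesRegularity.Theorems.LocalSineTubeDoorLocalPointZoomGradSlices
  (localPointZoomVelGradSlices)
open Summit.NavierStokesRegularity.NavierStokesRegularity.Theorems.LocalSineTubeDoorWindowFatou
open Summit.NavierStokesRegularity.NavierStokesRegularity.Theorems.PlaneStrainDoorZoomSpaceTimeDecay
  (hasTypeIDecay_of_zoom timeTypeI_of_spaceTimeTypeI)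
open Summit.NavierStokesRegularity.NavierStokesRegularity.Theorems.SelfStrainDoorDefs
open Summit.NavierStokesRegularity.NavierStokesRegularity.Theorems.SelfStrainDoorProfileRigidity

/-! ### The self-strain as a first-order scalar `F(x, A) = ⟪x, A x⟫` of (velocity, gradient) -/

/-- `(x, A) ↦ ⟪x, A x⟫` is continuous. -/
theorem continuous_selfStrainScalar :
    Continuous fun q : EuclideanSpace ℝ (Fin 3) × (EuclideanSpace ℝ (Fin 3) →L[ℝ] EuclideanSpace ℝ (Fin 3)) =>
      ⟪q.1, q.2 q.1⟫ :=
  continuous_fst.inner (continuous_snd.clm_apply continuous_fst)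

/-- Dilation law `⟪a•x, (b•A)(a•x)⟫ = a²b ⟪x, A x⟫` (the self-strain has scale dimension `−4` under the parabolic zoom). -/
theorem selfStrainScalar_smul (a b : ℝ) (x : EuclideanSpace ℝ (Fin 3))
    (A : EuclideanSpace ℝ (Fin 3) →L[ℝ] EuclideanSpace ℝ (Fin 3)) :
    ⟪a • x, (b • A) (a • x)⟫ = a ^ 2 * b * ⟪x, A x⟫ := by
  rw [smul_apply, map_smul, real_inner_smul_left, real_inner_smul_right, real_inner_smul_right]
  ring

/-- The zero set of `F(x, A) = ⟪x, A x⟫` is invariant under positive rescalings of its arguments. -/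
theorem selfStrainScalar_smul_eq_zero_iff {a b : ℝ} (ha : 0 < a) (hb : 0 < b) (x : EuclideanSpace ℝ (Fin 3))
    (A : EuclideanSpace ℝ (Fin 3) →L[ℝ] EuclideanSpace ℝ (Fin 3)) :
    ⟪a • x, (b • A) (a • x)⟫ = 0 ↔ ⟪x, A x⟫ = 0 := by
  rw [selfStrainScalar_smul]
  have h : a ^ 2 * b ≠ 0 := mul_ne_zero (pow_ne_zero 2 ha.ne') hb.ne'
  constructor
  · intro h0
    rcases mul_eq_zero.1 h0 with h1 | h1
    · exact absurd h1 h
    · exact h1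
  · intro h0
    rw [h0, mul_zero]

/-- The window integrand of the door in the shape of the tree's window glue: for `c ≥ 0`,
`c⁴ |σ(u)(x)| = |⟪c•u x, (c²•Du(x))(c•u x)⟫|`. -/
theorem selfStrain_window_integrand {c : ℝ} (hc : 0 ≤ c) (u : EuclideanSpace ℝ (Fin 3) → EuclideanSpace ℝ (Fin 3))
    (x : EuclideanSpace ℝ (Fin 3)) :
    c ^ 4 * |selfStrain u x| = |⟪c • u x, (c ^ 2 • fderiv ℝ u x) (c • u x)⟫| := by
  rw [selfStrainScalar_smul, selfStrain_apply, abs_mul, show c ^ 2 * c ^ 2 = c ^ 4 by ring,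
    abs_of_nonneg (pow_nonneg hc 4)]

/-! ### K1: the zoom profile is self-strain-free on a window of every slice -/

/-- **K1 · `LocalPointZoomSelfStrainWindow` (door S22), PROVED from the tree's universal zoom.**  Under the leaf's hypotheses
(Clay class, local SPACE–TIME Type-I bound at `(x₀,T)` with constants `ρ, M`), the `L¹`-fading of the scale-normalised
self-strain `(T−t)²|σ(u(t))(x₀ + √(T−t)y)|` on ONE nonempty open window `U`, and `¬` backward bounded at `x₀`: there are
`C, D` and a profile `v` of the door class (Type I in time `C`, space–time decay `D`, continuous on the open slab,
unit-viscosity Oseen-mild, divergence-free slices), backward-singular at `(0,0)`, and SELF-STRAIN-FREE on a nonempty open set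
of every slice `s < 0`.  Proof: the universal first-order zoom `localPointZoomVelGradSlices` (velocities and gradients
converge pointwise along one sequence), `hasTypeIDecay_of_zoom` (the space–time bound passes to the limit), and the window
glue `windowFatou_firstOrder_of_zeroSetInvariant` with `F(x, A) = ⟪x, A x⟫` on the window `(√(−s)/√ν) • U`. -/
theorem localPointZoomSelfStrainWindow :
    ∀ (ν T : ℝ), 0 < ν → 0 < T → ∀ (u : ℝ → EuclideanSpace ℝ (Fin 3) → EuclideanSpace ℝ (Fin 3))
      (p : ℝ → EuclideanSpace ℝ (Fin 3) → ℝ),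
    Literature.Analysis.FluidPDE.IsClassicalNSSolutionOn (Set.Ico 0 T) ν 0 u p →
    Literature.Analysis.FluidPDE.IsLerayHopfOn T ν 0 (u 0) u →
    Literature.Analysis.FluidPDE.HasRapidSpatialDecay (u 0) →
    ∀ (x₀ : EuclideanSpace ℝ (Fin 3)) (ρ M : ℝ), 0 < ρ →
    (∀ t ∈ Set.Ico 0 T, T - ρ ^ 2 < t → ∀ x ∈ Metric.ball x₀ ρ,
      ‖u t x‖ * (‖x - x₀‖ + Real.sqrt (ν * (T - t))) ≤ M) →
    ∀ (U : Set (EuclideanSpace ℝ (Fin 3))), IsOpen U → U.Nonempty →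
    Filter.Tendsto (fun t => ∫⁻ y in U, ENNReal.ofReal
      (Real.sqrt (T - t) ^ 4 * |selfStrain (u t) (x₀ + Real.sqrt (T - t) • y)|)) (nhdsWithin T (Set.Iio T)) (nhds 0) →
    ¬ Literature.Analysis.FluidPDE.IsBackwardBoundedAt u T x₀ →
    ∃ (C D : ℝ) (v : ℝ → EuclideanSpace ℝ (Fin 3) → EuclideanSpace ℝ (Fin 3)),
      Literature.Analysis.FluidPDE.HasTypeITimeDecay C v ∧ Literature.Analysis.FluidPDE.HasTypeIDecay D v ∧
      ContinuousOn (Function.uncurry v) (Set.Iio (0 : ℝ) ×ˢ Set.univ) ∧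
      (∀ s t : ℝ, s < t → t < 0 → ∀ x, v t x =
        Literature.Analysis.UnboundedOperators.heatExtension (v s) (t - s) x -
          Literature.Analysis.FluidPDE.oseenDuhamel 1 s v v t x) ∧
      (∀ t < 0, Literature.Analysis.FluidPDE.VectorCalculus.IsDivFree (v t)) ∧
      Literature.Analysis.FluidPDE.IsBackwardSingularPoint v 0 ∧
      (∀ s < 0, ∃ U : Set (EuclideanSpace ℝ (Fin 3)), IsOpen U ∧ U.Nonempty ∧ ∀ z ∈ U, selfStrain (v s) z = 0) := by
  intro ν T hν hT u p hcl hLH hdec x₀ ρ M hρ hM U hU hUne hfade hnot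
  obtain ⟨C, v, lam, hlam, hlam0, ⟨hrate, hcont, hmild, hdiv⟩, hsing, hconv⟩ :=
    localPointZoomVelGradSlices ν T hν hT u p hcl hLH hdec x₀ ρ M hρ (timeTypeI_of_spaceTimeTypeI hM) hnot
  have hdecay : HasTypeIDecay (M / ν) v :=
    hasTypeIDecay_of_zoom hν hT hρ hlam hlam0 hM fun s hs y => (hconv s hs y).1
  refine ⟨C, M / ν, v, hrate, hdecay, hcont, hmild, hdiv, hsing, fun s hs => ?_⟩
  -- the fading hypothesis in the shape of the window glue
  have hfade' : Tendsto (fun t => ∫⁻ y in U, ENNReal.ofReal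
      |⟪Real.sqrt (T - t) • u t (x₀ + Real.sqrt (T - t) • y),
        (Real.sqrt (T - t) ^ 2 • fderiv ℝ (u t) (x₀ + Real.sqrt (T - t) • y))
          (Real.sqrt (T - t) • u t (x₀ + Real.sqrt (T - t) • y))⟫|) (𝓝[<] T) (𝓝 0) := by
    refine hfade.congr fun t => ?_
    refine lintegral_congr fun y => ?_
    rw [selfStrain_window_integrand (Real.sqrt_nonneg (T - t))]
  -- the window in profile coordinates
  have hns : 0 < -s := neg_pos.2 hs
  set σ : ℝ := Real.sqrt (-s) / Real.sqrt ν with hσ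
  have hσpos : 0 < σ := div_pos (Real.sqrt_pos.2 hns) (Real.sqrt_pos.2 hν)
  refine ⟨(fun z => σ⁻¹ • z) ⁻¹' U, hU.preimage (continuous_const_smul σ⁻¹), ?_, fun z hz => ?_⟩
  · obtain ⟨u₀, hu₀⟩ := hUne
    refine ⟨σ • u₀, ?_⟩
    show σ⁻¹ • (σ • u₀) ∈ U
    rwa [smul_smul, inv_mul_cancel₀ hσpos.ne', one_smul]
  · rw [selfStrain_apply]
    exact windowFatou_firstOrder_of_zeroSetInvariant hν hT hcl hlam hlam0 hrate hcont hmild hconv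
      (fun (x : EuclideanSpace ℝ (Fin 3)) (A : EuclideanSpace ℝ (Fin 3) →L[ℝ] EuclideanSpace ℝ (Fin 3)) => ⟪x, A x⟫)
      continuous_selfStrainScalar (fun a b ha hb x A => selfStrainScalar_smul_eq_zero_iff ha hb x A) hU hfade' hs hz

/-! ### The door -/

/-- **DOOR S22 «SelfStrainDoor» — PROVED (unconditionally on the tree; a CONDITIONAL door theorem).**  A classical
Navier–Stokes solution on `[0,T)` (viscosity `ν > 0`), Leray–Hopf from a rapidly decaying datum, locally SPACE–TIME Type I at
`(x₀,T)` — `‖u(t,x)‖ (‖x − x₀‖ + √(ν(T−t))) ≤ M` on `B(x₀,ρ) × (T−ρ²,T)` — whose scale-normalised SELF-STRAIN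
`(T−t)² |σ(u(t))(x₀ + √(T−t) y)|`, `σ(u) = ⟪u, (u·∇)u⟫ = (u·∇)½|u|²`, fades in `L¹(U)` as `t ↑ T` on ONE nonempty open
similarity window `U`, is backward bounded at `x₀` (`u` stays bounded on some `B(x₀,r) × (T−r²,T)`).  «A locally Type-I
singularity must keep straining itself along its own streamlines on every similarity window, to the end.»  Proof: K1
`localPointZoomSelfStrainWindow` and the residue K2 `…SelfStrainDoorProfileRigidity.selfStrainFreeProfileRigidity`.
Text of nsreg-p1's `Target` (ROUND-21) verbatim.  WHAT THIS IS NOT: not NS regularity — the Type-I rate and the fading are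
hypotheses; the hard cores are evaded, not attacked. -/
theorem selfStrainDoor :
    ∀ (ν T : ℝ), 0 < ν → 0 < T → ∀ (u : ℝ → EuclideanSpace ℝ (Fin 3) → EuclideanSpace ℝ (Fin 3))
      (p : ℝ → EuclideanSpace ℝ (Fin 3) → ℝ),
    Literature.Analysis.FluidPDE.IsClassicalNSSolutionOn (Set.Ico 0 T) ν 0 u p →
    Literature.Analysis.FluidPDE.IsLerayHopfOn T ν 0 (u 0) u →
    Literature.Analysis.FluidPDE.HasRapidSpatialDecay (u 0) →
    ∀ (x₀ : EuclideanSpace ℝ (Fin 3)) (ρ M : ℝ), 0 < ρ →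
    (∀ t ∈ Set.Ico 0 T, T - ρ ^ 2 < t → ∀ x ∈ Metric.ball x₀ ρ,
      ‖u t x‖ * (‖x - x₀‖ + Real.sqrt (ν * (T - t))) ≤ M) →
    ∀ (U : Set (EuclideanSpace ℝ (Fin 3))), IsOpen U → U.Nonempty →
    Filter.Tendsto (fun t => ∫⁻ y in U, ENNReal.ofReal
      (Real.sqrt (T - t) ^ 4 * |selfStrain (u t) (x₀ + Real.sqrt (T - t) • y)|)) (nhdsWithin T (Set.Iio T)) (nhds 0) →
    Literature.Analysis.FluidPDE.IsBackwardBoundedAt u T x₀ := by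
  intro ν T hν hT u p hcl hLH hdec x₀ ρ M hρ hM U hU hUne hfade
  by_contra hnot
  obtain ⟨C, D, v, hrate, hdecay, hcont, hmild, hdiv, hsing, hwin⟩ :=
    localPointZoomSelfStrainWindow ν T hν hT u p hcl hLH hdec x₀ ρ M hρ hM U hU hUne hfade hnot
  exact selfStrainFreeProfileRigidity C D v hrate hdecay hcont hmild hdiv hwin hsing

end Summit.NavierStokesRegularity.NavierStokesRegularity.Theorems.SelfStrainDoor

end
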